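/-
Soloist `solo-ValiantsHypothesis-informed`, session 21 — support doubling: free subsets of sumsets.
-/
import Mathlib

/-!
# Support doubling: `k`-subset sums of a free set inside a sumset

This is the finite core of Proposition 7.68(ii) of the soloist note `paper/quadspan.md` §7.15
(a rank-uniform constraint on refuters of Conjecture Q*).  Let `X` be a finite set in an additive
commutative group, `E ⊆ X + X`, and suppose `E` is `(2k, 1)`-FREE in the sense used throughout the
`SoloInformed*` files (`SoloQuadSpanBound`): every relation `∑_{e ∈ E} c e • e = 0` with at most `2k`
nonzero coefficients, all of absolute value `≤ 1`, is trivial on `E`.  Then the `k`-subset sums of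
`E` are pairwise distinct and lie in `k • (X + X) = (k + k) • X`, so

  `C(|E|, k) ≤ |(k + k) • X| ≤ (|X + X| / |X|)^(k + k) · |X|`

by the Plünnecke–Ruzsa inequality (Mathlib).  In the note this is combined with an even-girth bound
to give `|E| ≤ C_k |X + X|^{2/3 + 2/(3k)}`; here we land exactly the two displayed inequalities:

* `soloInformed_kSubsetSums_injOn`   : freeness ⟹ `S ↦ ∑ S` is injective on `k`-subsets of `E`;
* `soloInformed_choose_le_card_nsmul` : `C(|E|, k) ≤ |k • (X + X)|` for `(2k,1)`-free `E ⊆ X + X`;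
* `soloInformed_supportDoubling`      : `C(|E|, k) ≤ (|X+X|/|X|)^(k+k) · |X|` (in `ℚ≥0`).
-/

namespace Summit.ValiantsHypothesis.ValiantsHypothesis.Theorems

open Finset
open scoped Pointwise

variable {G : Type*} [AddCommGroup G] [DecidableEq G]

/-- `(K, h)`-freeness of a finite set `E` in an additive group, with integer coefficients acting by
`zsmul`: every relation with at most `K` nonzero coefficients of absolute value `≤ h` is trivial. -/
def SoloFree (K h : ℕ) (E : Finset G) : Prop :=
  ∀ c : G → ℤ, (E.filter fun e => c e ≠ 0).card ≤ K → (∀ e, |c e| ≤ h) →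
    (∑ e ∈ E, c e • e) = 0 → ∀ e ∈ E, c e = 0

/-- A finite sum of elements of `F` indexed by `S` lies in `S.card • F`. -/
theorem soloInformed_sum_mem_card_nsmul {ι : Type*} [DecidableEq ι] (F : Finset G) (S : Finset ι)
    (f : ι → G) (h : ∀ i ∈ S, f i ∈ F) : (∑ i ∈ S, f i) ∈ S.card • F := by
  induction S using Finset.induction_on with
  | empty => simp
  | insert a S ha ih =>
    rw [sum_insert ha, card_insert_of_notMem ha, succ_nsmul, add_comm (f a)]
    exact add_mem_add (ih fun i hi => h i (mem_insert_of_mem hi)) (h a (mem_insert_self a S))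

/-- Freeness to order `2k` and height `1` makes `S ↦ ∑_{e ∈ S} e` injective on `k`-subsets. -/
theorem soloInformed_kSubsetSums_injOn (k : ℕ) (E : Finset G) (hfree : SoloFree (2 * k) 1 E) :
    Set.InjOn (fun S : Finset G => ∑ e ∈ S, e) (E.powersetCard k : Set (Finset G)) := by
  intro S hS T hT hST
  simp only [mem_coe, mem_powersetCard] at hS hT
  obtain ⟨hSE, hSk⟩ := hS
  obtain ⟨hTE, hTk⟩ := hT
  -- the signed indicator of `S` minus that of `T`
  set c : G → ℤ := fun e => (if e ∈ S then 1 else 0) - (if e ∈ T then 1 else 0) with hc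
  have hsupp : (E.filter fun e => c e ≠ 0).card ≤ 2 * k := by
    calc (E.filter fun e => c e ≠ 0).card ≤ (S ∪ T).card := by
          apply card_le_card
          intro e he
          rw [mem_filter] at he
          rw [mem_union]
          by_contra hne
          push Not at hne
          apply he.2
          simp [hc, hne.1, hne.2]
      _ ≤ S.card + T.card := card_union_le S T
      _ = 2 * k := by rw [hSk, hTk]; ring
  have hht : ∀ e, |c e| ≤ (1 : ℕ) := by
    intro e
    simp only [hc, Nat.cast_one]
    split_ifs <;> simp
  have hsum : (∑ e ∈ E, c e • e) = 0 := by
    have h1 : ∀ U : Finset G, U ⊆ E →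
        (∑ e ∈ E, (if e ∈ U then (1 : ℤ) else 0) • e) = ∑ e ∈ U, e := by
      intro U hU
      have : ∀ e ∈ E, (if e ∈ U then (1 : ℤ) else 0) • e = if e ∈ U then e else 0 := by
        intro e _
        split_ifs <;> simp
      rw [sum_congr rfl this, sum_ite_mem, inter_eq_right.mpr hU]
    have : ∀ e ∈ E, c e • e =
        (if e ∈ S then (1 : ℤ) else 0) • e - (if e ∈ T then (1 : ℤ) else 0) • e := by
      intro e _
      simp only [hc, sub_smul]
    rw [sum_congr rfl this, sum_sub_distrib, h1 S hSE, h1 T hTE, sub_eq_zero]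
    exact hST
  have hzero := hfree c hsupp hht hsum
  -- conclude `S = T`
  apply Subset.antisymm
  · intro e heS
    by_contra heT
    have := hzero e (hSE heS)
    simp [hc, heS, heT] at this
  · intro e heT
    by_contra heS
    have := hzero e (hTE heT)
    simp [hc, heS, heT] at this

/-- **Support doubling, combinatorial form.**  If `E ⊆ X + X` is `(2k,1)`-free then
`C(|E|, k) ≤ |k • (X + X)|`. -/
theorem soloInformed_choose_le_card_nsmul (k : ℕ) (E X : Finset G) (hEX : E ⊆ X + X)
    (hfree : SoloFree (2 * k) 1 E) : (E.card).choose k ≤ (k • (X + X)).card := by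
  rw [← card_powersetCard]
  refine card_le_card_of_injOn (fun S : Finset G => ∑ e ∈ S, e) (fun S hS => ?_)
    (soloInformed_kSubsetSums_injOn k E hfree)
  simp only [mem_coe, mem_powersetCard] at hS
  have h := soloInformed_sum_mem_card_nsmul (X + X) S (fun e => e) fun e he => hEX (hS.1 he)
  rw [hS.2] at h
  exact mem_coe.mpr h

/-- **Support doubling (Proposition 7.68(ii) of the note).**  If `E ⊆ X + X` is `(2k,1)`-free and
`X` is nonempty then `C(|E|, k) ≤ (|X + X| / |X|)^(k + k) · |X|` (Plünnecke–Ruzsa). -/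
theorem soloInformed_supportDoubling (k : ℕ) (E X : Finset G) (hX : X.Nonempty) (hEX : E ⊆ X + X)
    (hfree : SoloFree (2 * k) 1 E) :
    ((E.card).choose k : ℚ≥0) ≤ ((X + X).card / X.card : ℚ≥0) ^ (k + k) * X.card := by
  have h1 : ((E.card).choose k : ℚ≥0) ≤ ((k • (X + X)).card : ℚ≥0) := by
    exact_mod_cast soloInformed_choose_le_card_nsmul k E X hEX hfree
  have h2 : k • (X + X) = (k + k) • X := by rw [nsmul_add, add_nsmul]
  rw [h2] at h1
  exact h1.trans (pluennecke_ruzsa_inequality_nsmul_add hX X (k + k))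

end Summit.ValiantsHypothesis.ValiantsHypothesis.Theorems
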